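import Summits.Ventures.HodgeRepro2.T5FinitePlaceBinaryUniversalInert

/-!
# `(U)` at ANY finite non-split place where `−1` is a local norm — the wild places included
(cell pub-hodge-repro2, seat p3)

Tier-5 N2 support, rows N2.2.2 / N2.8.1 of route/T5-N2-route-3.md. Files 143 / 144 proved `(U)` at the
non-dyadic and at the inert places; the ramified dyadic places stayed a binder. Here a different sufficient
condition, valid at EVERY finite non-split place: if `−1 ∈ N(E_w^×)` then `(U′)` and hence `(U)` hold.

* `isSumTwoNorms_of_neg_one_mem`: for a non-norm `y` choose a square `n = ϖ^{−2k}` of very low valuation; then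
  `y − n = −n · (1 − y/n)` with `1 − y/n ≡ 1 mod 4𝔪` (seat p4's `T5NormGroupOpen`: such units are norms), so
  `y − n ∈ (−1)·N·N = N` and `y = (y − n) + n` is a sum of two norms;
* **`binaryUniversal_of_neg_one_isUnitNorm`**: `(U)` on `E_w` whenever `−1 = star u · u` for some unit `u` of
  `E_w`, at any finite non-split place (through file 144's `binaryUniversal_of_forall_isSumTwoNorms`), with the
  three corollaries there.

The condition `−1 ∈ N(E_w^×)` is `(−1, θ)_v = 1` in Hilbert-symbol language (file 138); it holds for instance when
`−1` is a `v`-adic square. Mathlib + this seat's files 141–144 and seat p4's chain through them only; no display;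
no device. §8(d): uses an L-value-free non-vanishing device: NO.
-/

namespace Summit.Ventures.HodgeRepro2.T5FinitePlaceNegOneNorm

open IsDedekindDomain IsDedekindDomain.HeightOneSpectrum NumberField Module WithZero
open Summit.Ventures.HodgeRepro2.T5FinitePlaceTensorEquiv Summit.Ventures.HodgeRepro2.T5FinitePlaceStar
  Summit.Ventures.HodgeRepro2.T5FinitePlaceIsometryCriterion Summit.Ventures.HodgeRepro2.T5HilbertSymbolNorm
  Summit.Ventures.HodgeRepro2.T5HermitianDetClass Summit.Ventures.HodgeRepro2.T5HermitianClassify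
  Summit.Ventures.HodgeRepro2.T5HermitianTwoClasses Summit.Ventures.HodgeRepro2.T5AdicCompletionNormGroup
  Summit.Ventures.HodgeRepro2.T5LocalNormIndex Summit.Ventures.HodgeRepro2.T5FinitePlaceNormIndex
  Summit.Ventures.HodgeRepro2.T5FinitePlaceSumTwoNorms Summit.Ventures.HodgeRepro2.T5FinitePlaceBinaryUniversal
  Summit.Ventures.HodgeRepro2.T5FinitePlaceBinaryUniversalInert

section Local

variable {K : Type*} [Field K] [NumberField K] (v : HeightOneSpectrum (NumberField.RingOfIntegers K))
  {L : Type*} [Field L] [NumberField L] [Algebra K L]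
  (w : HeightOneSpectrum (NumberField.RingOfIntegers L)) [w.asIdeal.LiesOver v.asIdeal]
  (σ : Gal(adicCompletion L w/adicCompletion K v))

/-- **`(U′)` at any finite place where `−1` is a norm:** every unit of `Kᵥ` is a sum of two norms from `L_w`. -/
theorem isSumTwoNorms_of_neg_one_mem (hneg : (-1 : (adicCompletion K v)ˣ) ∈ normGroup v w σ)
    (y : (adicCompletion K v)ˣ) : IsSumTwoNorms v w σ y := by
  by_cases hy : y ∈ normGroup v w σ
  · exact isSumTwoNorms_of_mem v w σ hy
  obtain ⟨ϖ, hϖ⟩ := exists_irreducible_adicCompletionIntegers v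
  haveI : CharZero (adicCompletion K v) :=
    charZero_of_injective_algebraMap (algebraMap ℚ (adicCompletion K v)).injective
  have hy0 : Valued.v (y : adicCompletion K v) ≠ 0 := (Valuation.ne_zero_iff _).2 y.ne_zero
  have h40 : Valued.v (4 : adicCompletion K v) ≠ 0 := (Valuation.ne_zero_iff _).2 (by norm_num)
  obtain ⟨a, ha⟩ : ∃ a : ℤ, Valued.v (y : adicCompletion K v) = exp a := ⟨_, (exp_log hy0).symm⟩
  obtain ⟨b, hb⟩ : ∃ b : ℤ, Valued.v (4 : adicCompletion K v) = exp b := ⟨_, (exp_log h40).symm⟩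
  -- the square `n = ϖ^{−2k}` with `2k > a − b`
  set k : ℕ := (a - b).toNat + 1 with hk
  have hk' : a - (2 * (k : ℤ)) < b := by
    have := Int.self_le_toNat (a - b)
    omega
  set n : (adicCompletion K v)ˣ := (uniformizerUnit v hϖ ^ (-(k : ℤ))) ^ 2 with hn
  have hnN : n ∈ normGroup v w σ := T5NormGroupOpen.sq_mem_normGroup v w σ _
  have hnv : Valued.v (n : adicCompletion K v) = exp (2 * (k : ℤ)) := by
    rw [hn, Units.val_pow_eq_pow_val, Units.val_zpow_eq_zpow_val, coe_uniformizerUnit, map_pow, map_zpow₀,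
      val_uniformizer v hϖ, ← exp_zsmul, ← exp_nsmul]
    congr 1
    simp only [smul_eq_mul, nsmul_eq_mul, Nat.cast_ofNat]
    ring
  have hn0 : (n : adicCompletion K v) ≠ 0 := n.ne_zero
  -- `u = 1 − y/n` is a unit with `v (u − 1) < v 4`
  have hu0 : (1 : adicCompletion K v) - (y : adicCompletion K v) / (n : adicCompletion K v) ≠ 0 := by
    intro h
    apply hy
    have hyn : (y : adicCompletion K v) = n := by
      rw [sub_eq_zero, eq_comm, div_eq_one_iff_eq hn0] at h
      exact h
    rw [Units.ext hyn]
    exact hnN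
  set u : (adicCompletion K v)ˣ := Units.mk0 _ hu0 with hu
  have huN : u ∈ normGroup v w σ := by
    apply T5NormGroupOpen.mem_normGroup_of_val_sub_one_lt_val_four v w σ u
    rw [hu, Units.val_mk0, sub_sub_cancel_left, Valuation.map_neg, map_div₀, ha, hnv, hb, ← exp_sub, exp_lt_exp]
    exact hk'
  -- `y = (−1) · n · u + n`
  obtain ⟨x₁, hx₁⟩ := Subgroup.mul_mem _ (Subgroup.mul_mem _ hneg hnN) huN
  obtain ⟨x₂, hx₂⟩ := hnN
  refine ⟨x₁, x₂, ?_⟩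
  rw [hx₁, hx₂, ← map_add]
  congr 1
  rw [Units.val_mul, Units.val_mul, Units.val_neg, Units.val_one, hu, Units.val_mk0]
  field_simp
  ring

end Local

section Universal

variable {F E : Type*} [Field F] [NumberField F] [Field E] [NumberField E] [Algebra F E]
  [Algebra.IsQuadraticExtension F E]
variable (v : HeightOneSpectrum (𝓞 F)) (w : HeightOneSpectrum (𝓞 E)) [w.asIdeal.LiesOver v.asIdeal]
variable {s : E} {θ : F}
variable (hs : s ^ 2 = algebraMap F E θ) (hspan : Submodule.span F {(1 : E), s} = ⊤)
  (hsq : ¬ IsSquare (algebraMap F (v.adicCompletion F) θ)) (c : E ≃ₐ[F] E) (hc : c s = -s)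

/-- **`(U)` on `E_w` at any finite non-split place where `−1` is a norm** (`−1 = star u · u` for a unit `u` of
`E_w`), the ramified dyadic places included. -/
theorem binaryUniversal_of_neg_one_isUnitNorm
    (hneg : letI := localStarRing v w hs hspan hsq c hc; IsUnitNorm (-1 : w.adicCompletion E)) :
    letI := localStarRing v w hs hspan hsq c hc
    BinaryUniversal (w.adicCompletion E) := by
  letI := localStarRing v w hs hspan hsq c hc
  have hneg' : (-1 : (v.adicCompletion F)ˣ) ∈ normGroup v w (localConj v w hs hspan hsq c) := by
    rw [← isUnitNorm_iff_mem_normGroup v w hs hspan hsq c hc, Units.val_neg, Units.val_one, map_neg, map_one]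
    exact hneg
  exact binaryUniversal_of_forall_isSumTwoNorms v w hs hspan hsq c hc fun y =>
    isSumTwoNorms_of_neg_one_mem v w (localConj v w hs hspan hsq c) hneg' y

/-- Shimura's Lemma 1.6 on `E_w`, unconditional at any finite non-split place where `−1` is a norm. -/
theorem isCongruent_iff_exists_det_eq_local_of_neg_one
    (hneg : letI := localStarRing v w hs hspan hsq c hc; IsUnitNorm (-1 : w.adicCompletion E))
    {ι : Type*} [Fintype ι] [DecidableEq ι] {H H' : Matrix ι ι (w.adicCompletion E)}
    (hH : letI := localStarRing v w hs hspan hsq c hc; H.IsHermitian)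
    (hH' : letI := localStarRing v w hs hspan hsq c hc; H'.IsHermitian) (hdet : IsUnit H.det) :
    letI := localStarRing v w hs hspan hsq c hc
    IsCongruent H H' ↔ ∃ u : w.adicCompletion E, u ≠ 0 ∧ H'.det = star u * u * H.det := by
  letI := localStarRing v w hs hspan hsq c hc
  exact isCongruent_iff_exists_det_eq (exists_add_star_ne_zero_local v w hs hspan hsq c hc)
    (binaryUniversal_of_neg_one_isUnitNorm v w hs hspan hsq c hc hneg) hH hH' hdet

/-- HKS96's «precisely two isomorphism classes in each dimension» on `E_w`, unconditional at any finite non-split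
place where `−1` is a norm. -/
theorem exists_two_classes_local_of_neg_one
    (hneg : letI := localStarRing v w hs hspan hsq c hc; IsUnitNorm (-1 : w.adicCompletion E)) (m : ℕ) :
    letI := localStarRing v w hs hspan hsq c hc
    ∃ H₁ H₂ : Matrix (Fin (m + 1)) (Fin (m + 1)) (w.adicCompletion E),
      H₁.IsHermitian ∧ H₂.IsHermitian ∧ IsUnit H₁.det ∧ IsUnit H₂.det ∧ ¬ IsCongruent H₁ H₂ ∧
        ∀ H : Matrix (Fin (m + 1)) (Fin (m + 1)) (w.adicCompletion E), H.IsHermitian → IsUnit H.det →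
          IsCongruent H H₁ ∨ IsCongruent H H₂ := by
  letI := localStarRing v w hs hspan hsq c hc
  exact exists_two_classes_local v w hs hspan hsq c hc
    (binaryUniversal_of_neg_one_isUnitNorm v w hs hspan hsq c hc hneg) m

end Universal

end Summit.Ventures.HodgeRepro2.T5FinitePlaceNegOneNorm
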